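import Mathlib

/-!
# Solo-blind kernel #129 — identities of the degenerate-ridge corner

Steady-door programme (solo-blind), paper §24.82–24.83 (session s75).  Three groups of exact
identities used by the corner variant of the construction (carrier at a hump-splitting cusp of the
global leaf-exponent maximum):

1. **The λ = 0 landing reduction.**  For the landing inner system `α'' = (ξ + M) α`,
   `M - λ³ M''' = -(α²)'''`, write `β = α'`, `W = ξ + M`.  Along any solution,
   `(α²)' = 2αβ`, `(2αβ)' = 2β² + 2Wα²`, `(2β² + 2Wα²)' = 8Wαβ + 2α²W'` — so
   `(α²)''' = 8Wαβ + 2α²(1 + M')`, and at `λ = 0` the equation `M = -(α²)'''` is equivalent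
   (where `α ≠ 0`) to the first-order law `M' = -1 - (M + 8Wαβ)/(2α²)`: the landing problem
   becomes a THIRD-order system (paper 24.82(1)).
2. **The cusp normal form.**  Near an `A₃` point the profile is `½ s₂ X² - c₄ X⁴` (plus tilt and
   height); with `w² = s₂/(4 c₄)` and `X = w t` it is EXACTLY `δ (2t² - t⁴)`, `δ = s₂²/(16 c₄)`:
   hump half-separation `w`, relief `δ` (paper 24.83(3)).
3. **The dial moments at the exact landing of kernel #106.**  With `r² = 6`, lift-off
   `x₀ = -(2/3) r`, landing `x_e = r/2`, live width `w_l = 7r/6`, the moments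
   `J_k = ∫₀^{w_l} (3ρ - w_l)(ρ - w_l)(x_e - ρ)^k dρ` entering the transversality determinant of
   kernel #128 are `J₀ = 0` (for every width: the height direction is degenerate),
   `J₁ = J₃ = 2401/432`, `J₂ = (2401/6480) r` (paper 24.83(3), claim SB-C775).
All proofs are algebra (`ring`, `field_simp`, `linear_combination`) on top of Mathlib's
`HasDerivAt` calculus and `integral_pow`.
-/

namespace Summit.AnomalousDissipation.AnomalousDissipation.Theorems

open intervalIntegral

/-! ### 1. The λ = 0 landing reduction -/

/-- First derivative of the pattern intensity `u = α²` along the landing flow: `(α²)' = 2αβ`. -/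
theorem landing_sq_hasDerivAt (α β : ℝ → ℝ) (x : ℝ) (hα : HasDerivAt α (β x) x) :
    HasDerivAt (fun y => α y ^ 2) (2 * α x * β x) x := by
  have e : (fun y => α y ^ 2) = fun y => α y * α y := by funext y; ring
  rw [e]
  exact (hα.fun_mul hα).congr_deriv (by ring)

/-- Second derivative: `(2αβ)' = 2β² + 2Wα²` when `α' = β`, `β' = Wα`. -/
theorem landing_sq_second_hasDerivAt (α β W : ℝ → ℝ) (x : ℝ) (hα : HasDerivAt α (β x) x)
    (hβ : HasDerivAt β (W x * α x) x) :
    HasDerivAt (fun y => 2 * α y * β y) (2 * β x ^ 2 + 2 * W x * α x ^ 2) x := by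
  have e : (fun y => 2 * α y * β y) = fun y => 2 * (α y * β y) := by funext y; ring
  rw [e]
  exact ((hα.fun_mul hβ).const_mul 2).congr_deriv (by ring)

/-- Third derivative: `(2β² + 2Wα²)' = 8Wαβ + 2α²·W'` when `α' = β`, `β' = Wα`, `W' = w₁`.
With `W = ξ + M` one has `w₁ = 1 + M'`, whence `(α²)''' = 8Wαβ + 2α²(1 + M')`
(paper 24.82(1)). -/
theorem landing_sq_third_hasDerivAt (α β W : ℝ → ℝ) (x w₁ : ℝ) (hα : HasDerivAt α (β x) x)
    (hβ : HasDerivAt β (W x * α x) x) (hW : HasDerivAt W w₁ x) :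
    HasDerivAt (fun y => 2 * β y ^ 2 + 2 * W y * α y ^ 2)
      (8 * W x * α x * β x + 2 * α x ^ 2 * w₁) x := by
  have h1 : HasDerivAt (fun y => 2 * (β y * β y)) (2 * (W x * α x * β x + β x * (W x * α x))) x :=
    (hβ.fun_mul hβ).const_mul 2
  have h2 : HasDerivAt (fun y => 2 * (W y * (α y * α y)))
      (2 * (w₁ * (α x * α x) + W x * (β x * α x + α x * β x))) x :=
    (hW.fun_mul (hα.fun_mul hα)).const_mul 2
  have e : (fun y => 2 * β y ^ 2 + 2 * W y * α y ^ 2) =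
      fun y => 2 * (β y * β y) + 2 * (W y * (α y * α y)) := by funext y; ring
  rw [e]
  exact (h1.fun_add h2).congr_deriv (by ring)

/-- The λ = 0 slaving law.  With `(α²)''' = 8Wαβ + 2α²(1 + M₁)` (`M₁ = M'`), the equation
`M = -(α²)'''` is equivalent, where `α ≠ 0`, to `M₁ = -1 - (M + 8Wαβ)/(2α²)` — the third
component of the reduced third-order system R of paper 24.82(1). -/
theorem landing_lambda_zero_slaving (α β W M M₁ : ℝ) (hα : α ≠ 0) :
    M = -(8 * W * α * β + 2 * α ^ 2 * (1 + M₁)) ↔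
      M₁ = -1 - (M + 8 * W * α * β) / (2 * α ^ 2) := by
  have h2 : (2 : ℝ) * α ^ 2 ≠ 0 := mul_ne_zero two_ne_zero (pow_ne_zero 2 hα)
  constructor
  · intro h
    rw [h]
    field_simp
    ring
  · intro h
    rw [h]
    field_simp
    ring

/-- At a zero of `1 + 8αβ` the slaved value of `M` (the numerator of the slaving law set to zero,
`M + 8(ξ + M)αβ = -2α²(1 + M₁)` read at leading order) is singular: if `1 + 8αβ = 0` then
`M + 8(ξ + M)αβ = 8ξαβ = -ξ/1 · 1`, i.e. the coefficient of `M` vanishes.  Recorded as the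
algebraic fact behind the 'M-spike' of paper 24.82(1). -/
theorem landing_spike_coefficient (ξ α β M : ℝ) (h : 1 + 8 * α * β = 0) :
    M + 8 * (ξ + M) * α * β = -ξ := by
  have : 8 * α * β = -1 := by linarith
  linear_combination (ξ + M) * this

/-! ### 2. The cusp normal form -/

/-- Scaling of the quartic-quadratic profile to the universal form: with `w² = s₂/(4c₄)`,
`½ s₂ (w t)² - c₄ (w t)⁴ = (s₂²/(16 c₄)) · (2t² - t⁴)`. -/
theorem cusp_normal_form_scaling (s₂ c₄ w t : ℝ) (hc : c₄ ≠ 0) (hw : w ^ 2 = s₂ / (4 * c₄)) :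
    s₂ / 2 * (w * t) ^ 2 - c₄ * (w * t) ^ 4 = s₂ ^ 2 / (16 * c₄) * (2 * t ^ 2 - t ^ 4) := by
  have e2 : (w * t) ^ 2 = w ^ 2 * t ^ 2 := by ring
  have e4 : (w * t) ^ 4 = (w ^ 2) ^ 2 * t ^ 4 := by ring
  rw [e2, e4, hw]
  field_simp
  ring

/-- The humps of `½ s₂ X² - c₄ X⁴` sit where `s₂ X - 4 c₄ X³ = 0`, i.e. at `X² = s₂/(4c₄) = w²`
for `X ≠ 0`. -/
theorem cusp_hump_location (s₂ c₄ X : ℝ) (hc : c₄ ≠ 0) (hX : X ≠ 0) :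
    s₂ * X - 4 * c₄ * X ^ 3 = 0 ↔ X ^ 2 = s₂ / (4 * c₄) := by
  have h4 : (4 : ℝ) * c₄ ≠ 0 := mul_ne_zero (by norm_num) hc
  constructor
  · intro h
    have : X * (s₂ - 4 * c₄ * X ^ 2) = 0 := by linear_combination h
    rcases mul_eq_zero.mp this with hx | hx
    · exact absurd hx hX
    · field_simp
      linarith
  · intro h
    rw [eq_div_iff h4] at h
    linear_combination (-X) * h

/-- The relief (hump height above the cusp level) is `½ s₂ w² - c₄ w⁴ = s₂²/(16 c₄) = δ`. -/
theorem cusp_relief (s₂ c₄ w : ℝ) (hc : c₄ ≠ 0) (hw : w ^ 2 = s₂ / (4 * c₄)) :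
    s₂ / 2 * w ^ 2 - c₄ * w ^ 4 = s₂ ^ 2 / (16 * c₄) := by
  have e4 : w ^ 4 = (w ^ 2) ^ 2 := by ring
  rw [e4, hw]
  field_simp
  ring

/-! ### 3. The dial moments at the exact landing -/

/-- A six-monomial interval integral in closed form. -/
theorem integral_six_monomials (a b c₁ c₂ c₃ c₄ c₅ c₆ : ℝ) (n₁ n₂ n₃ n₄ n₅ n₆ : ℕ) :
    ∫ t in a..b, (c₁ * t ^ n₁ + c₂ * t ^ n₂ + c₃ * t ^ n₃ + c₄ * t ^ n₄ + c₅ * t ^ n₅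
        + c₆ * t ^ n₆) =
      c₁ * ((b ^ (n₁ + 1) - a ^ (n₁ + 1)) / (n₁ + 1))
        + c₂ * ((b ^ (n₂ + 1) - a ^ (n₂ + 1)) / (n₂ + 1))
        + c₃ * ((b ^ (n₃ + 1) - a ^ (n₃ + 1)) / (n₃ + 1))
        + c₄ * ((b ^ (n₄ + 1) - a ^ (n₄ + 1)) / (n₄ + 1))
        + c₅ * ((b ^ (n₅ + 1) - a ^ (n₅ + 1)) / (n₅ + 1))
        + c₆ * ((b ^ (n₆ + 1) - a ^ (n₆ + 1)) / (n₆ + 1)) := by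
  rw [integral_add (by apply Continuous.intervalIntegrable; fun_prop)
        (by apply Continuous.intervalIntegrable; fun_prop),
    integral_add (by apply Continuous.intervalIntegrable; fun_prop)
        (by apply Continuous.intervalIntegrable; fun_prop),
    integral_add (by apply Continuous.intervalIntegrable; fun_prop)
        (by apply Continuous.intervalIntegrable; fun_prop),
    integral_add (by apply Continuous.intervalIntegrable; fun_prop)
        (by apply Continuous.intervalIntegrable; fun_prop),
    integral_add (by apply Continuous.intervalIntegrable; fun_prop)
        (by apply Continuous.intervalIntegrable; fun_prop),
    intervalIntegral.integral_const_mul, intervalIntegral.integral_const_mul,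
    intervalIntegral.integral_const_mul, intervalIntegral.integral_const_mul,
    intervalIntegral.integral_const_mul, intervalIntegral.integral_const_mul,
    integral_pow, integral_pow, integral_pow, integral_pow, integral_pow, integral_pow]

/-- The dial weight `(3ρ - w)(ρ - w)` of kernel #128 has zero mean on `[0, w]` for EVERY width `w`:
the height direction of the unfolding is degenerate (`J₀ = 0`). -/
theorem dialMoment0_eq_zero (w : ℝ) :
    ∫ ρ in (0 : ℝ)..w, (3 * ρ - w) * (ρ - w) = 0 := by
  rw [intervalIntegral.integral_congr
        (g := fun ρ => (3 : ℝ) * ρ ^ 2 + (-4 * w) * ρ ^ 1 + w ^ 2 * ρ ^ 0 + 0 * ρ ^ 0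
          + 0 * ρ ^ 0 + 0 * ρ ^ 0)
        (fun ρ _ => by ring),
    integral_six_monomials]
  push_cast; ring

/-- `J₁ = ∫₀^{7r/6} (3ρ - 7r/6)(ρ - 7r/6)(r/2 - ρ) dρ = 2401/432` when `r² = 6`
(lift-off `x₀ = -(2/3)r`, landing `x_e = r/2`, width `w_l = 7r/6` of kernel #106). -/
theorem dialMoment1_landing (r : ℝ) (hr : r ^ 2 = 6) :
    ∫ ρ in (0 : ℝ)..(7 * r / 6), (3 * ρ - 7 * r / 6) * (ρ - 7 * r / 6) * (r / 2 - ρ)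
      = 2401 / 432 := by
  rw [intervalIntegral.integral_congr
        (g := fun ρ => (-3 : ℝ) * ρ ^ 3 + (37 / 6 * r) * ρ ^ 2 + (-(133 / 36) * r ^ 2) * ρ ^ 1
          + (49 / 72 * r ^ 3) * ρ ^ 0 + 0 * ρ ^ 0 + 0 * ρ ^ 0)
        (fun ρ _ => by ring),
    integral_six_monomials]
  push_cast
  linear_combination ((2401 : ℝ) / 15552 * (r ^ 2 + 6)) * hr

/-- `J₂ = ∫₀^{7r/6} (3ρ - 7r/6)(ρ - 7r/6)(r/2 - ρ)² dρ = (2401/6480) r` when `r² = 6`. -/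
theorem dialMoment2_landing (r : ℝ) (hr : r ^ 2 = 6) :
    ∫ ρ in (0 : ℝ)..(7 * r / 6), (3 * ρ - 7 * r / 6) * (ρ - 7 * r / 6) * (r / 2 - ρ) ^ 2
      = 2401 / 6480 * r := by
  rw [intervalIntegral.integral_congr
        (g := fun ρ => (3 : ℝ) * ρ ^ 4 + (-(23 / 3) * r) * ρ ^ 3 + (61 / 9 * r ^ 2) * ρ ^ 2
          + (-(91 / 36) * r ^ 3) * ρ ^ 1 + (49 / 144 * r ^ 4) * ρ ^ 0 + 0 * ρ ^ 0)
        (fun ρ _ => by ring),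
    integral_six_monomials]
  push_cast
  linear_combination ((2401 : ℝ) / 233280 * r * (r ^ 2 + 6)) * hr

/-- `J₃ = ∫₀^{7r/6} (3ρ - 7r/6)(ρ - 7r/6)(r/2 - ρ)³ dρ = 2401/432` when `r² = 6`. -/
theorem dialMoment3_landing (r : ℝ) (hr : r ^ 2 = 6) :
    ∫ ρ in (0 : ℝ)..(7 * r / 6), (3 * ρ - 7 * r / 6) * (ρ - 7 * r / 6) * (r / 2 - ρ) ^ 3
      = 2401 / 432 := by
  rw [intervalIntegral.integral_congr
        (g := fun ρ => (-3 : ℝ) * ρ ^ 5 + (55 / 6 * r) * ρ ^ 4 + (-(191 / 18) * r ^ 2) * ρ ^ 3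
          + (71 / 12 * r ^ 3) * ρ ^ 2 + (-(77 / 48) * r ^ 4) * ρ ^ 1 + (49 / 288 * r ^ 5) * ρ ^ 0)
        (fun ρ _ => by ring),
    integral_six_monomials]
  push_cast
  linear_combination ((2401 : ℝ) / 93312 * (r ^ 4 + 6 * r ^ 2 + 36)) * hr

/-- The curious coincidence `J₁ = J₃` at the exact landing (both equal `7⁴/432`). -/
theorem dialMoment1_eq_dialMoment3 (r : ℝ) (hr : r ^ 2 = 6) :
    ∫ ρ in (0 : ℝ)..(7 * r / 6), (3 * ρ - 7 * r / 6) * (ρ - 7 * r / 6) * (r / 2 - ρ)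
      = ∫ ρ in (0 : ℝ)..(7 * r / 6), (3 * ρ - 7 * r / 6) * (ρ - 7 * r / 6) * (r / 2 - ρ) ^ 3 := by
  rw [dialMoment1_landing r hr, dialMoment3_landing r hr]

/-- The instance `r = √6`. -/
theorem dialMoments_sqrt6 :
    (∫ ρ in (0 : ℝ)..(7 * √6 / 6), (3 * ρ - 7 * √6 / 6) * (ρ - 7 * √6 / 6) * (√6 / 2 - ρ)
        = 2401 / 432) ∧
    (∫ ρ in (0 : ℝ)..(7 * √6 / 6), (3 * ρ - 7 * √6 / 6) * (ρ - 7 * √6 / 6) * (√6 / 2 - ρ) ^ 2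
        = 2401 / 6480 * √6) ∧
    (∫ ρ in (0 : ℝ)..(7 * √6 / 6), (3 * ρ - 7 * √6 / 6) * (ρ - 7 * √6 / 6) * (√6 / 2 - ρ) ^ 3
        = 2401 / 432) := by
  have hr : (√6 : ℝ) ^ 2 = 6 := Real.sq_sqrt (by norm_num)
  exact ⟨dialMoment1_landing _ hr, dialMoment2_landing _ hr, dialMoment3_landing _ hr⟩

end Summit.AnomalousDissipation.AnomalousDissipation.Theorems
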